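import Summits.BirchSwinnertonDyer.BirchSwinnertonDyer.Theorems.GenusKolyvaginAtTwoMultiGenusPrimitivityAtTwoAuxiliaryFieldRowOneOddTwist
import Summits.BirchSwinnertonDyer.BirchSwinnertonDyer.Theorems.GenusKolyvaginAtTwoMultiGenusPrimitivityAtTwoOfOddTwist

/-!
# Route `GenusKolyvaginAtTwo`, crux stmt-BirchSwinnertonDyer-24947 `MultiGenusPrimitivityAtTwo` (U): the open input in its final
# currency — «the rational genus point `z₀` is not in `2·W^{(ℓ*)}(ℚ)`»

Lead prover seat bsd-line-gk2-p1 (g6). The odd multiples in the odd-twist form of AUX-PRIMITIVITY (p617773 / p618536 / p618828: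
«no odd multiple of `z₀` lies in `2·W^{(ℓ*)}(ℚ)`») are redundant: in any abelian group, `2z = m z₀` with `m = 2k+1` gives
`z₀ = 2(z − k z₀)` (`not_two_dvd_iff_forall_odd`). Hence the two conditional results of this lineage in their FINAL currency:
* `heegner_exists_multiGenusCertificate_rowOne_of_cor34i_of_oddTwistNotTwoDvd` — on WALL row 1 (`Δ(W) < 0`, `ρ̄_{W,2}` onto,
  `#Sel₂(W) = 4`, Heegner `K` with odd `d_K ≠ −3`, globally minimal twin `Wd ≅ W^{(d_K)}` with `#Sel₂ = 2`, `M₀ ≥ 1`) the crux's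
  `∃`-certificate follows from Mazur–Rubin Cor. 3.4 (i) (print, `h34`) and: at every Kolyvagin prime `ℓ ≡ 7 (8)` with Sel₂-trivial
  even genus twist, every rational point `z₀ ∈ W^{(ℓ*)}(ℚ)` whose transport `Φ(ι z₀)` is an odd multiple of the reduced genus point
  `W_ℓ` satisfies `z₀ ∉ 2·W^{(ℓ*)}(ℚ)`;
* `multiGenusPrimitivityAtTwo_of_oddTwistNotTwoDvd` — U BY NAME from the corresponding package hypothesis.
Both CONDITIONAL (open kernel = W. Zhang's base case of Kolyvagin's conjecture read at `p = 2`: 2-indivisibility of one rational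
point on one rank-one quadratic twist); BSD is not proved by any of this.

References: [GrossLMS1991] §3–§5; [McCallumLMS1991] §5; [MazurRubin2010] Cor. 3.4 (i); [WZhang2014] Thm. 1.1 (the `p ≥ 5` prototype).
-/

set_option linter.dupNamespace false -- tree convention: `Summit.BirchSwinnertonDyer.BirchSwinnertonDyer.Theorems` (summit = sub-problem)

noncomputable section

open scoped Classical

namespace Summit.BirchSwinnertonDyer.BirchSwinnertonDyer.Theorems.GenusKoly

open Finset NumberField WeierstrassCurve Literature.NumberTheory.EllipticCurves
  Literature.NumberTheory.EllipticCurves.ModularForms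
  Summit.BirchSwinnertonDyer.Rank1Residual.AdditivePotMult
  Summit.BirchSwinnertonDyer.Rank1Residual.X11b.RingClassConj
  Summit.BirchSwinnertonDyer.BirchSwinnertonDyer.Theses.GenusKolyvaginAtTwo

/-- **Odd multiples are redundant for 2-divisibility.** In an abelian group, «no odd multiple of `z₀` is divisible by `2`» iff
«`z₀` is not divisible by `2`»: `2z = (2k+1) z₀` gives `z₀ = 2(z − k z₀)`. [folklore] -/
theorem not_two_dvd_iff_forall_odd {A : Type*} [AddCommGroup A] (z₀ : A) :
    (∀ m : ℕ, Odd m → ¬ ∃ z : A, (2 : ℤ) • z = (m : ℤ) • z₀) ↔ ¬ ∃ z : A, (2 : ℤ) • z = z₀ := by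
  constructor
  · rintro h ⟨z, hz⟩
    exact h 1 odd_one ⟨z, by rw [hz, Nat.cast_one, one_smul]⟩
  · rintro h m ⟨k, rfl⟩ ⟨z, hz⟩
    refine h ⟨z - (k : ℤ) • z₀, ?_⟩
    rw [smul_sub, hz, smul_smul, ← sub_smul]
    have h1 : (((2 * k + 1 : ℕ) : ℤ) - 2 * (k : ℤ)) = 1 := by push_cast; ring
    rw [h1, one_smul]

section Heegner

variable {W : WeierstrassCurve ℚ} [NeZero (W.conductorNorm ℤ)] {K : Type} [Field K] [NumberField K]
  {Dt : ModularParametrizationData W (W.conductorNorm ℤ)} {β : ℤ} {ι : K →+* ℂ}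

/-- **WALL ROW 1, FINAL CURRENCY: the crux's certificate from Cor. 3.4 (i) and «`z₀ ∉ 2·W^{(ℓ*)}(ℚ)`».** As
`heegner_exists_multiGenusCertificate_rowOne_of_cor34i_of_oddTwistPrimitive` (p618536) with the odd multiples removed from the
open hypothesis (`not_two_dvd_iff_forall_odd`): IF at every Kolyvagin prime `ℓ ≡ 7 (8)` at `2` whose even genus twist `Wd^{(−ℓ)}`
has all elliptic models Sel₂-trivial, for all data / radicals / enumerations / reduced genus points `W_ℓ`, every rational point `z₀`
of the odd twist `W^{(ℓ*)}` with `Φ(ι z₀)` an odd multiple of `W_ℓ` is NOT twice a rational point of `W^{(ℓ*)}`, THEN the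
certificate clause of `MultiGenusPrimitivityAtTwo` / `stub_positiveDepth` holds on row 1. CONDITIONAL on `h34` (print) and
`hprim` (open). [cite: MazurRubin2010, Cor. 3.4 (i)] [cite: GrossLMS1991, §3 (3.1)–(3.5), §4 (4.1), Lemma 4.3, §5]
[cite: McCallumLMS1991, §5] [cite: WZhang2014, Thm. 1.1 (the p ≥ 5 prototype)] -/
theorem heegner_exists_multiGenusCertificate_rowOne_of_cor34i_of_oddTwistNotTwoDvd [W.IsElliptic] [W.IsGloballyMinimal]
    (h34 : MazurRubin2010.cor34i_singleton_rat)
    (hK : IsImaginaryQuadratic K) (hodd : Odd (NumberField.discr K)) (h3 : NumberField.discr K ≠ -3)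
    (hH : SatisfiesHeegnerHypothesis (W.conductorNorm ℤ) K) (hsurj : W.HasSurjectiveModNGaloisRep ((2 : ℤ) ^ 1))
    (hΔ : W.Δ < 0) (h4 : Nat.card (W.selmerGroup 2) = 4)
    {Wd : WeierstrassCurve ℚ} [Wd.IsElliptic] [Wd.IsGloballyMinimal] {C : VariableChange ℚ}
    (hWd : C • W.quadraticTwist (NumberField.discr K : ℚ) = Wd) (h2 : Nat.card (Wd.selmerGroup 2) = 2)
    (d₁ : KolyvaginHeegnerData Dt β ι 1)
    (hM : ∃ Q₁ : (W.baseChange (ringClassField K ι 1)).toAffine.Point, (2 : ℤ) • Q₁ = d₁.derivedPoint)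
    (hprim : ∀ ℓ : ℕ, ℓ.Prime → ℓ % 8 = 7 → Zhang2014.IsKolyvaginPrime (W.conductorNorm ℤ) W K 2 ℓ →
      (∀ (W₂ : WeierstrassCurve ℚ) [W₂.IsElliptic],
        (∃ C₂ : VariableChange ℚ, C₂ • Wd.quadraticTwist (-(ℓ : ℚ)) = W₂) → Nat.card (W₂.selmerGroup 2) = 1) →
      ∀ (d : KolyvaginHeegnerData Dt β ι ℓ) (θ : ℕ → ringClassField K ι ℓ),
        (∀ ℓ' ∈ ℓ.primeFactors, θ ℓ' ^ 2 = algebraMap ℚ (ringClassField K ι ℓ) ((-1 : ℚ) ^ (ℓ' / 2) * ℓ')) →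
      ∀ (hθQ : θ ℓ ∉ Set.range (algebraMap ℚ (ringClassField K ι ℓ)))
        (hθℓ : θ ℓ ^ 2 = algebraMap ℚ (ringClassField K ι ℓ) ((-1 : ℚ) ^ (ℓ / 2) * ℓ)),
      ∀ (G : Finset (ringClassField K ι ℓ ≃ₐ[ℚ] ringClassField K ι ℓ)), (∀ g, g ∈ G ↔ g ∈ ringClassGal ι ℓ) →
      ∀ (Wn : (W.baseChange (ringClassField K ι ℓ)).toAffine.Point),
        ((2 : ℤ) ^ ℓ.primeFactors.card) • Wn =
          ∑ g ∈ G, (∏ ℓ' ∈ ℓ.primeFactors, (if g (θ ℓ') = θ ℓ' then (1 : ℤ) else -1)) •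
            pointGalHom W (ringClassField K ι ℓ) g d.y →
      ∀ (m₀ : ℕ) (z₀ : (W.quadraticTwist ((-1 : ℚ) ^ (ℓ / 2) * ℓ)).toAffine.Point), Odd m₀ →
        twistPointEquivOver W hθQ hθℓ
          (QuadraticDescent.incl (ringClassField K ι ℓ : Type) (W.quadraticTwist ((-1 : ℚ) ^ (ℓ / 2) * ℓ)) z₀) =
            (m₀ : ℤ) • Wn →
      ¬ ∃ z : (W.quadraticTwist ((-1 : ℚ) ^ (ℓ / 2) * ℓ)).toAffine.Point, (2 : ℤ) • z = z₀) :
    ∃ (n : ℕ) (d : KolyvaginHeegnerData Dt β ι n) (θ : ℕ → ringClassField K ι n)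
      (T : Finset (ringClassField K ι n ≃ₐ[ℚ] ringClassField K ι n)),
      Squarefree n ∧ (∀ ℓ ∈ n.primeFactors, Zhang2014.IsKolyvaginPrime (W.conductorNorm ℤ) W K 2 ℓ) ∧
      (∀ ℓ ∈ n.primeFactors, θ ℓ ^ 2 = algebraMap ℚ (ringClassField K ι n) ((-1 : ℚ) ^ (ℓ / 2) * ℓ)) ∧
      (∀ g, g ∈ T ↔ g ∈ ringClassGal ι n ∧ ∀ ℓ ∈ n.primeFactors, g (θ ℓ) = θ ℓ) ∧
      ¬ ∃ Q : (W.baseChange (ringClassField K ι n)).toAffine.Point, (2 : ℤ) • Q =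
        ∑ g ∈ T, pointGalHom W (ringClassField K ι n) g d.y :=
  heegner_exists_multiGenusCertificate_rowOne_of_cor34i_of_oddTwistPrimitive h34 hK hodd h3 hH hsurj hΔ h4 hWd h2 d₁ hM
    fun ℓ hℓ hℓ8 hKolyZ hSel1 d θ hθ hθQ hθℓ G hG Wn hWn m₀ z₀ hm₀ hz₀ ↦
      (not_two_dvd_iff_forall_odd z₀).mpr (hprim ℓ hℓ hℓ8 hKolyZ hSel1 d θ hθ hθQ hθℓ G hG Wn hWn m₀ z₀ hm₀ hz₀)

end Heegner

/-- **U BY NAME, FINAL CURRENCY.** `MultiGenusPrimitivityAtTwo` follows from the displayed hypothesis `hprim`: every instance of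
U's binders with `2 ∣ P(1)` carries an odd-twist package (Kolyvagin prime `ℓ`, datum, radicals, enumeration, reduced genus point
`W_ℓ`, `√d ∈ K ∖ ℚ` with a Sel₂-trivial elliptic model of `W^{(ℓ*·d)}`, `θ_ℓ ∉ ℚ`) in which every rational `z₀ ∈ W^{(ℓ*)}(ℚ)` with
`Φ(ι z₀)` an odd multiple of `W_ℓ` is not twice a rational point. As `multiGenusPrimitivityAtTwo_of_oddTwistPrimitive` (p618828)
with the odd multiples removed (`not_two_dvd_iff_forall_odd`). CONDITIONAL on `hprim` (open).
[cite: GrossLMS1991, §3 (3.1)–(3.5), §4 (4.1), Lemma 4.3, §5] [cite: McCallumLMS1991, §5] [cite: WZhang2014, Thm. 1.1] -/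
theorem multiGenusPrimitivityAtTwo_of_oddTwistNotTwoDvd
    (hprim : ∀ (W : WeierstrassCurve ℚ) [W.IsElliptic] [W.IsGloballyMinimal] [NeZero (W.conductorNorm ℤ)], ¬ W.HasCM →
      W.analyticRank = 0 → (∀ n : ℕ, 0 < n → W.HasSurjectiveModNGaloisRep ((2 : ℤ) ^ n)) → Odd W.tamagawaProduct →
      ∀ (K : Type) [Field K] [NumberField K], IsImaginaryQuadratic K →
      Odd (NumberField.discr K) → NumberField.discr K ≠ -3 → SatisfiesHeegnerHypothesis (W.conductorNorm ℤ) K →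
      ¬ IsSquare ((NumberField.discr K : ℚ) * -|W.Δ|) → ¬ IsSquare ((NumberField.discr K : ℚ) * (-(2 * |W.Δ|))) →
      ∀ (Dt : ModularParametrizationData W (W.conductorNorm ℤ)),
      (∀ z ∈ Dt.L.lattice, ∃ w ∈ periodLattice Dt.f, z = (Dt.c : ℂ) * w) →
      Odd Dt.c → ∀ (β : ℤ) (ι : K →+* ℂ) (d₁ : KolyvaginHeegnerData Dt β ι 1),
      ¬ IsOfFinAddOrder d₁.derivedPoint → ∀ (Wd : WeierstrassCurve ℚ) [Wd.IsElliptic] [Wd.IsGloballyMinimal],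
      (∃ C : VariableChange ℚ, C • W.quadraticTwist (NumberField.discr K : ℚ) = Wd) → Wd.analyticRank = 1 →
      Nat.card (Wd.selmerGroup 2) = 2 →
      (∃ Q : (W.baseChange (ringClassField K ι 1)).toAffine.Point, (2 : ℤ) • Q = d₁.derivedPoint) →
      ∃ (ℓ : ℕ) (d : KolyvaginHeegnerData Dt β ι ℓ) (θ : ℕ → ringClassField K ι ℓ)
        (G : Finset (ringClassField K ι ℓ ≃ₐ[ℚ] ringClassField K ι ℓ))
        (Wn : (W.baseChange (ringClassField K ι ℓ)).toAffine.Point)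
        (s₀ : K) (dK : ℚ) (We : WeierstrassCurve ℚ) (_ : We.IsElliptic)
        (hθQ : θ ℓ ∉ Set.range (algebraMap ℚ (ringClassField K ι ℓ)))
        (hθℓ : θ ℓ ^ 2 = algebraMap ℚ (ringClassField K ι ℓ) ((-1 : ℚ) ^ (ℓ / 2) * ℓ)),
        ℓ.Prime ∧ (∀ ℓ' ∈ ℓ.primeFactors, Zhang2014.IsKolyvaginPrime (W.conductorNorm ℤ) W K 2 ℓ') ∧
        (∀ ℓ' ∈ ℓ.primeFactors, θ ℓ' ^ 2 = algebraMap ℚ (ringClassField K ι ℓ) ((-1 : ℚ) ^ (ℓ' / 2) * ℓ')) ∧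
        (∀ g, g ∈ G ↔ g ∈ ringClassGal ι ℓ) ∧
        s₀ ∉ Set.range (algebraMap ℚ K) ∧ s₀ ^ 2 = algebraMap ℚ K dK ∧
        (∃ C : VariableChange ℚ, C • W.quadraticTwist (((-1 : ℚ) ^ (ℓ / 2) * ℓ) * dK) = We) ∧
        Nat.card (We.selmerGroup 2) = 1 ∧
        ((2 : ℤ) ^ ℓ.primeFactors.card) • Wn =
          ∑ g ∈ G, (∏ ℓ' ∈ ℓ.primeFactors, (if g (θ ℓ') = θ ℓ' then (1 : ℤ) else -1)) •
            pointGalHom W (ringClassField K ι ℓ) g d.y ∧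
        ∀ (m₀ : ℕ) (z₀ : (W.quadraticTwist ((-1 : ℚ) ^ (ℓ / 2) * ℓ)).toAffine.Point), Odd m₀ →
          twistPointEquivOver W hθQ hθℓ
            (QuadraticDescent.incl (ringClassField K ι ℓ : Type) (W.quadraticTwist ((-1 : ℚ) ^ (ℓ / 2) * ℓ)) z₀) =
              (m₀ : ℤ) • Wn →
          ¬ ∃ z : (W.quadraticTwist ((-1 : ℚ) ^ (ℓ / 2) * ℓ)).toAffine.Point, (2 : ℤ) • z = z₀) :
    MultiGenusPrimitivityAtTwo := by
  refine multiGenusPrimitivityAtTwo_of_oddTwistPrimitive ?_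
  intro W _ _ _ hcm hr0 hρ hT K _ _ hIQ hodd h3 hHe hsq1 hsq2 Dt hopt hc β ι d₁ hy Wd _ _ hWd hrd hSel hM
  obtain ⟨ℓ, d, θ, G, Wn, s₀, dK, We, hWe, hθQ, hθℓ, hℓ, hKoly, hθ, hG, hs₀, hs₀2, hC, hSelWe, hWn, hz⟩ :=
    hprim W hcm hr0 hρ hT K hIQ hodd h3 hHe hsq1 hsq2 Dt hopt hc β ι d₁ hy Wd hWd hrd hSel hM
  exact ⟨ℓ, d, θ, G, Wn, s₀, dK, We, hWe, hθQ, hθℓ, hℓ, hKoly, hθ, hG, hs₀, hs₀2, hC, hSelWe, hWn,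
    fun m₀ z₀ hm₀ hz₀ ↦ (not_two_dvd_iff_forall_odd z₀).mpr (hz m₀ z₀ hm₀ hz₀)⟩

end Summit.BirchSwinnertonDyer.BirchSwinnertonDyer.Theorems.GenusKoly

end
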